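import Summits.Ventures.PercRepro.S1FourCircuitCountSharpA
import Summits.Ventures.PercRepro.RankLevelSetCorankFiveCounts

/-!
# PercRepro — THE SHARP FIVE-CIRCUIT COUNT AT BOUNDED NULLITY, PART A: the triangles of a matroid with lines `≤ 8` points,
`4·s₃ + 7ν ≤ 7ν² + 14` (p8, gen 19; a feeder for S4 — the top of the `q = 7` window, the row `65`)

LEMMA T5 (`S1.fortyEight_mul_ncard_five_circuits_le` at `a = 7`: `48·s₅ ≤ 7ν(ν+1)(ν+2)(ν+3)`) rests on the ladder's
triangle count `4·s₃ ≤ 7ν(ν+1)` for matroids with lines `≤ 8` points (`M ／ {e} ／ {x}` of the `e`-free core at level `7`: the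
rank-`4` sets of the core have `≤ 10` points). The «+1» of S1FourCircuitCountSharpB at `a = 7`:
* **`four_mul_ncard_triangles_add_le_of_lines_eight`** — for lines `≤ 8` points: `4·s₃ + 7ν ≤ 7ν² + 14`
  (`s₃ ≤ (7ν² − 7ν + 14)/4`; tight at `U_{2,8}`, `ν = 6`), against `4·s₃ ≤ 7ν(ν + 1)`. The deletion induction of Part B:
  delete a point `y` on a triangle with a triangle `C` off every line through `y` (`2·t_y + 7 ≤ 7ν`, Part A of the
  four-circuit count); if the first point `x` has none, every triangle spans `x` — all through `x` (`2·s₃ ≤ 7ν`), or a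
  triangle `T'` avoids `x` and a point `y ∈ T'` with `{x, y}` independent has one unless every triangle lies on the line
  `cl T'` (`s₃ ≤ C(|cl T'|, 3) ≤ 56`, `|cl T'| − 2 ≤ ν`).
Parts B, C (S1FiveCircuitCountSharpB / C) climb to `12·s₄ ≤ 7ν³ + 35ν` under «planes ≤ 9» and
`48·s₅ ≤ 7ν(ν+1)(ν² + ν + 10)` under «rank-`4` sets ≤ 10». Axioms: standard.
-/

open scoped Matroid

namespace PercRepro

namespace S1

open Set

variable {α : Type}

/-- **THE SHARP TRIANGLE COUNT FOR LINES WITH `≤ 8` POINTS**: if `|E| = r(E) + d` and every rank-`2` set has at most `8`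
points, then `4·s₃ + 7d ≤ 7d² + 14` (`s₃ ≤ (7d² − 7d + 14)/4`; tight at `U_{2,8}`). Deletion induction on `|E|`: delete a point
`y` of a triangle with a triangle `C` off every line through `y` (`2·t_y + 7 ≤ 7d`); if the first point `x` has none, every
triangle spans `x` — all pass through `x` (`2·s₃ ≤ 7d`), or a triangle `T'` avoids `x` and a point `y ∈ T'` with `{x, y}`
independent has one unless every triangle lies on the line `cl T'` (`s₃ ≤ C(|cl T'|, 3) ≤ 56`, `|cl T'| ≤ 2 + d`). -/
theorem four_mul_ncard_triangles_add_le_of_lines_eight (N : Matroid α) [N.Finite]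
    (hflat : ∀ X ⊆ N.E, N.eRk X ≤ 2 → X.ncard ≤ 8) {d : ℕ} (hd : N.E.encard = N.eRank + d) :
    4 * (ThmN.triangles N).ncard + 7 * d ≤ 7 * d * d + 14 := by
  suffices H : ∀ n : ℕ, ∀ (N : Matroid α) [N.Finite], N.E.ncard = n →
      (∀ X ⊆ N.E, N.eRk X ≤ 2 → X.ncard ≤ 8) → ∀ d : ℕ, N.E.encard = N.eRank + d →
      4 * (ThmN.triangles N).ncard + 7 * d ≤ 7 * d * d + 14 from H _ N rfl hflat d hd
  intro n
  induction n using Nat.strong_induction_on with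
  | _ n ih =>
  intro N _ hn hflat d hd
  classical
  set S := ThmN.triangles N with hS
  have hSfin : S.Finite :=
    N.ground_finite.finite_subsets.subset (fun C hC => hC.1.subset_ground)
  have hflat7 : ∀ X ⊆ N.E, N.eRk X ≤ 2 → X.ncard ≤ 7 + 1 := fun X hX hr => hflat X hX hr
  have hdd : d ≤ d * d := by
    rcases Nat.eq_zero_or_pos d with h | h
    · rw [h]
    · exact Nat.le_mul_of_pos_left d h
  by_cases hSe : S = ∅
  · rw [hSe, ncard_empty, mul_zero, zero_add]; nlinarith
  obtain ⟨C₀, hC₀⟩ := nonempty_iff_ne_empty.2 hSe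
  obtain ⟨x, hxC₀⟩ := hC₀.1.nonempty
  -- a non-loop on a triangle
  have nonloop : ∀ y : α, (∃ C' ∈ S, y ∈ C') → N.Indep {y} := by
    intro y ⟨C', hC'S, hyC'⟩
    have hyE : y ∈ N.E := hC'S.1.subset_ground hyC'
    rw [_root_.Matroid.indep_singleton, ← _root_.Matroid.not_isLoop_iff hyE]
    intro hloop
    have hC'y : C' = {y} := hloop.eq_of_isCircuit_mem hC'S.1 hyC'
    have := hC'S.2
    rw [hC'y, ncard_singleton] at this
    omega
  -- THE STEP: a point `y` on a triangle, with a triangle `C` off every line through `y`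
  have step : ∀ y : α, (∃ C' ∈ S, y ∈ C') → (∃ C ∈ S, y ∉ N.closure C) →
      4 * S.ncard + 7 * d ≤ 7 * d * d + 14 := by
    intro y hy hC
    obtain ⟨C', hC'S, hyC'⟩ := hy
    obtain ⟨C, hCS, hyC⟩ := hC
    have hyE : y ∈ N.E := hC'S.1.subset_ground hyC'
    have hne : ¬ N.IsColoop y := hC'S.1.not_isColoop_of_mem hyC'
    have hyI : N.Indep {y} := nonloop y ⟨C', hC'S, hyC'⟩
    have hν : N✶.eRank = (d : ℕ∞) := dual_eRank_eq_of_encard N hd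
    have hdel := PercRepro.Matroid.dual_eRank_delete_singleton_add_one hyE hne
    rw [hν] at hdel
    have hfin' : (N ＼ {y})✶.eRank ≠ ⊤ := by
      intro h
      rw [h] at hdel
      exact absurd hdel (by simp)
    obtain ⟨d', hd'⟩ := ENat.ne_top_iff_exists.1 hfin'
    have hdd' : d = d' + 1 := by
      rw [← hd'] at hdel
      exact_mod_cast hdel.symm
    have hd'enc : (N ＼ {y}).E.encard = (N ＼ {y}).eRank + d' := encard_eq_of_dual_eRank _ hd'.symm
    have hdelE : (N ＼ {y}).E.ncard < n := by
      rw [_root_.Matroid.delete_ground, ← hn, ← ncard_sdiff_singleton_add_one hyE N.ground_finite]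
      omega
    have hflat' : ∀ X ⊆ (N ＼ {y}).E, (N ＼ {y}).eRk X ≤ 2 → X.ncard ≤ 8 := by
      intro X hX hr
      rw [_root_.Matroid.delete_ground] at hX
      rw [delete_singleton_eRk_eq hX] at hr
      exact hflat X (hX.trans sdiff_subset) hr
    set S₁ := {C : Set α | N.IsCircuit C ∧ C.ncard = 3 ∧ y ∈ C} with hS₁
    set S₂ := {C : Set α | N.IsCircuit C ∧ C.ncard = 3 ∧ y ∉ C} with hS₂
    have hsplit : S ⊆ S₁ ∪ S₂ := by
      intro C hC
      by_cases h : y ∈ C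
      · exact Or.inl ⟨hC.1, hC.2, h⟩
      · exact Or.inr ⟨hC.1, hC.2, h⟩
    have hS₁fin : S₁.Finite := hSfin.subset (fun C hC => ⟨hC.1, hC.2.1⟩)
    have hS₂fin : S₂.Finite := hSfin.subset (fun C hC => ⟨hC.1, hC.2.1⟩)
    have h1 : 2 * S₁.ncard + 7 ≤ 7 * d :=
      two_mul_ncard_trianglesThrough_add_le N 7 hflat7 hyI hCS.1 hCS.2 hyC hd
    have h2 : 4 * S₂.ncard + 7 * d' ≤ 7 * d' * d' + 14 := by
      have hsub : S₂ ⊆ ThmN.triangles (N ＼ {y}) := by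
        intro C hC
        exact ⟨_root_.Matroid.delete_isCircuit_iff.2 ⟨hC.1, disjoint_singleton_right.2 hC.2.2⟩, hC.2.1⟩
      have := ih _ hdelE (N ＼ {y}) rfl hflat' d' hd'enc
      have hle : S₂.ncard ≤ (ThmN.triangles (N ＼ {y})).ncard :=
        ncard_le_ncard hsub
          ((N ＼ {y}).ground_finite.finite_subsets.subset (fun C hC => hC.1.subset_ground))
      omega
    have h3 : S.ncard ≤ S₁.ncard + S₂.ncard :=
      (ncard_le_ncard hsplit (hS₁fin.union hS₂fin)).trans (ncard_union_le _ _)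
    subst hdd'
    nlinarith [h1, h2, h3]
  have hxI : N.Indep {x} := nonloop x ⟨C₀, hC₀, hxC₀⟩
  by_cases hA : ∃ C ∈ S, x ∉ N.closure C
  · exact step x ⟨C₀, hC₀, hxC₀⟩ hA
  -- every triangle spans `x`
  have hA' : ∀ C ∈ S, x ∈ N.closure C := fun C hC => by_contra (fun h => hA ⟨C, hC, h⟩)
  by_cases hB : ∃ T' ∈ S, x ∉ T'
  · obtain ⟨T', hT'S, hxT'⟩ := hB
    have hT'E : T' ⊆ N.E := hT'S.1.subset_ground
    have hT'r : N.eRk T' = 2 := eRk_eq_two_of_ncard_three_circuit N hT'S.1 hT'S.2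
    -- a point `y ∈ T'` with `{x, y}` independent
    obtain ⟨y, hyT', hxy⟩ : ∃ y ∈ T', N.Indep ({x, y} : Set α) := by
      by_contra hcon
      have hall : ∀ y ∈ T', y ∈ N.closure {x} := by
        intro y hy
        by_contra hy'
        apply hcon
        refine ⟨y, hy, ?_⟩
        have hyx : y ∉ ({x} : Set α) := fun h => hxT' ((mem_singleton_iff.1 h) ▸ hy)
        rw [pair_comm]
        exact (hxI.insert_indep_iff_of_notMem hyx).2 ⟨hT'S.1.subset_ground hy, hy'⟩
      have hr : N.eRk T' ≤ 1 := by
        calc N.eRk T' ≤ N.eRk (N.closure {x}) := N.eRk_mono hall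
          _ = N.eRk {x} := N.eRk_closure_eq _
          _ = 1 := by rw [hxI.eRk_eq_encard, encard_singleton]
      rw [hT'r] at hr
      have : (2 : ℕ) ≤ 1 := by exact_mod_cast hr
      omega
    have hxy_ne : x ≠ y := fun h => hxT' (h ▸ hyT')
    set L := N.closure T' with hL
    have hLE : L ⊆ N.E := N.closure_subset_ground _
    have hLfin : L.Finite := N.ground_finite.subset hLE
    have hLr : N.eRk L = 2 := by rw [hL, N.eRk_closure_eq, hT'r]
    have hL8 : L.ncard ≤ 8 := hflat L hLE (le_of_eq hLr)
    have hT'L : T' ⊆ L := N.subset_closure T' hT'E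
    have hL3 : 3 ≤ L.ncard := by
      have := ncard_le_ncard hT'L hLfin
      rw [hT'S.2] at this; exact this
    have hLd : L.ncard ≤ 2 + d := by
      have h := PercRepro.Matroid.encard_le_eRk_add_of_encard_eq hLE hd
      rw [hLr, ← hLfin.cast_ncard_eq] at h
      exact_mod_cast h
    by_cases hC : ∀ C ∈ S, C ⊆ L
    · -- every triangle lies on the line `L`: `s₃ ≤ C(|L|, 3)`
      have hScard : S.ncard ≤ L.ncard.choose 3 := by
        have hsub : S ⊆ ((hLfin.toFinset.powersetCard 3).image (fun t : Finset α => (t : Set α)) : Set (Set α)) := by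
          intro C hCS
          have hCfin : C.Finite := hLfin.subset (hC C hCS)
          rw [Finset.coe_image]
          refine ⟨hCfin.toFinset, ?_, by simp⟩
          rw [Finset.mem_coe, Finset.mem_powersetCard]
          refine ⟨?_, ?_⟩
          · intro z hz
            rw [Finite.mem_toFinset] at hz ⊢
            exact hC C hCS hz
          · rw [← ncard_eq_toFinset_card C hCfin]; exact hCS.2
        calc S.ncard ≤ ((hLfin.toFinset.powersetCard 3).image (fun t : Finset α => (t : Set α)) : Set (Set α)).ncard :=
              ncard_le_ncard hsub (Finset.finite_toSet _)
          _ = ((hLfin.toFinset.powersetCard 3).image (fun t : Finset α => (t : Set α))).card := ncard_coe_finset _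
          _ ≤ (hLfin.toFinset.powersetCard 3).card := Finset.card_image_le
          _ = L.ncard.choose 3 := by
              rw [Finset.card_powersetCard, ncard_eq_toFinset_card L hLfin]
      obtain ⟨k, hk⟩ : ∃ k, L.ncard = k := ⟨_, rfl⟩
      rw [hk] at hScard hL8 hL3 hLd
      interval_cases k
      · rw [show Nat.choose 3 3 = 1 by decide] at hScard; nlinarith
      · rw [show Nat.choose 4 3 = 4 by decide] at hScard
        have := Nat.mul_le_mul_right d (show 2 ≤ d by omega); nlinarith
      · rw [show Nat.choose 5 3 = 10 by decide] at hScard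
        have := Nat.mul_le_mul_right d (show 3 ≤ d by omega); nlinarith
      · rw [show Nat.choose 6 3 = 20 by decide] at hScard
        have := Nat.mul_le_mul_right d (show 4 ≤ d by omega); nlinarith
      · rw [show Nat.choose 7 3 = 35 by decide] at hScard
        have := Nat.mul_le_mul_right d (show 5 ≤ d by omega); nlinarith
      · rw [show Nat.choose 8 3 = 56 by decide] at hScard
        have := Nat.mul_le_mul_right d (show 6 ≤ d by omega); nlinarith
    · obtain ⟨C, hCS, hCL⟩ : ∃ C ∈ S, ¬ C ⊆ L := by
        by_contra h
        exact hC (fun C hC' => by_contra (fun h' => h ⟨C, hC', h'⟩))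
      -- `y ∉ cl C`: else `cl {x, y} ⊆ cl C` forces `C ⊆ cl {x, y} ⊆ L`
      have hyC : y ∉ N.closure C := by
        intro hyC
        apply hCL
        have hxC : x ∈ N.closure C := hA' C hCS
        have hCE : C ⊆ N.E := hCS.1.subset_ground
        have hCcl : C ⊆ N.closure C := N.subset_closure C hCE
        have hXcl : C ∪ {x, y} ⊆ N.closure C :=
          union_subset hCcl (insert_subset hxC (singleton_subset_iff.2 hyC))
        have hXE : C ∪ {x, y} ⊆ N.E := hXcl.trans (N.closure_subset_ground _)
        have hXfin : (C ∪ {x, y}).Finite := N.ground_finite.subset hXE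
        have hxyr : N.eRk ({x, y} : Set α) = 2 := by rw [hxy.eRk_eq_encard, encard_pair hxy_ne]
        have hXr : N.eRk (C ∪ {x, y}) ≤ N.eRk ({x, y} : Set α) := by
          rw [hxyr]
          calc N.eRk (C ∪ {x, y}) ≤ N.eRk (N.closure C) := N.eRk_mono hXcl
            _ = N.eRk C := N.eRk_closure_eq _
            _ = 2 := eRk_eq_two_of_ncard_three_circuit N hCS.1 hCS.2
        have hXsub : C ∪ {x, y} ⊆ N.closure ({x, y} : Set α) :=
          ThmN.subset_closure_of_eRk_le N subset_union_right hXE hXfin hXr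
        have hxyL : ({x, y} : Set α) ⊆ N.closure T' :=
          insert_subset (hA' T' hT'S) (singleton_subset_iff.2 (hT'L hyT'))
        have hclL : N.closure ({x, y} : Set α) ⊆ L := N.closure_subset_closure_of_subset_closure hxyL
        exact (subset_union_left.trans hXsub).trans hclL
      exact step y ⟨T', hT'S, hyT'⟩ ⟨C, hCS, hyC⟩
  · -- every triangle passes through `x`: `s₃ = t_x ≤ 2d`
    have hall : S ⊆ {C : Set α | N.IsCircuit C ∧ C.ncard = 3 ∧ x ∈ C} :=
      fun C hC => ⟨hC.1, hC.2, by_contra (fun h => hB ⟨C, hC, h⟩)⟩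
    have h1 : 2 * {C : Set α | N.IsCircuit C ∧ C.ncard = 3 ∧ x ∈ C}.ncard ≤ 7 * d :=
      two_mul_ncard_trianglesThrough_le N 7 hflat7 hxI hd
    have h2 : S.ncard ≤ {C : Set α | N.IsCircuit C ∧ C.ncard = 3 ∧ x ∈ C}.ncard :=
      ncard_le_ncard hall (N.ground_finite.finite_subsets.subset (fun C hC => hC.1.subset_ground))
    have h3 : 21 * d ≤ 7 * d * d + 14 := by
      rcases Nat.lt_or_ge d 3 with h | h
      · interval_cases d <;> omega
      · have := Nat.mul_le_mul_right d h; nlinarith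
    nlinarith

end S1

end PercRepro
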